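import Literature.NumberTheory.LFunctions.WeilExplicit
import Literature.NumberTheory.LFunctions.WeilExplicitProofs
import Literature.NumberTheory.LFunctions.WeilMellinInversion
import Literature.NumberTheory.LFunctions.WeilArchimedeanPositivityProofs
import Literature.NumberTheory.LFunctions.WeilArchimedeanMoments
import Mathlib.MeasureTheory.Integral.Prod

/-!
# Stub B of line `Sketch` (crux `SignCone.OscCoherentCore`, stmt-RiemannHypothesis-18013):
spectral (convolution) form of the off-line defect

For a Weil test `g` supported in `[-a, a]`, `k = g ⋆ g̃` (so `tsupport k ⊆ [-2a, 2a]`), the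
per-zero defect `D_k(δ, γ) = ∫ k(u) (2cosh(δu) - 2) e^{iγu} du` equals
`(1/2π) ∫ |ĝ(1/2 + iξ)|² L̂_{a,δ}(γ - ξ) dξ`, where
`L̂_{a,δ}(η) = ∫ (2cosh(δu) - 2) χ_a(u) e^{iηu} du` and `χ_a(u) = (1 - x³)³`,
`x = min 1 (max 0 (|u| - 2a))` (`χ_a = 1` on `[-2a, 2a]`, `= 0` off `[-2a-1, 2a+1]`).

Proof: insert the cutoff (it is `1` on `tsupport k`), write `k` by Mellin (Fourier) inversion on
the critical line (`weilMellin_inversion`, `k̂(1/2 + iξ) = |ĝ(1/2 + iξ)|²`), and swap the two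
integrals (Fubini: `ξ ↦ k̂(1/2 + iξ)` is integrable, the cut-off kernel is continuous of compact
support, the character has modulus `1`).
-/

noncomputable section

-- `Summit.RiemannHypothesis.RiemannHypothesis.…` repeats a namespace component by design (D-0017 layout).
set_option linter.dupNamespace false

open scoped BigOperators ComplexConjugate Real
open Complex MeasureTheory Set Filter

namespace Summit.RiemannHypothesis.RiemannHypothesis.Theorems.OscCoherentCore

open Literature.NumberTheory.LFunctions

/-! ### The cutoff `χ_a` -/

/-- The cutoff `χ_a(u) = (1 - x³)³`, `x = min 1 (max 0 (|u| - 2a))`, equals `1` for `|u| ≤ 2a`.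
[folklore] -/
theorem signConeCutoff_eq_one {a u : ℝ} (hu : |u| ≤ 2 * a) :
    (1 - (min 1 (max 0 (|u| - 2 * a))) ^ 3) ^ 3 = 1 := by
  have h : max 0 (|u| - 2 * a) = 0 := max_eq_left (by linarith)
  rw [h, min_eq_right (zero_le_one' ℝ)]
  norm_num

/-- The cutoff `χ_a` vanishes for `|u| ≥ 2a + 1`. [folklore] -/
theorem signConeCutoff_eq_zero {a u : ℝ} (hu : 2 * a + 1 ≤ |u|) :
    (1 - (min 1 (max 0 (|u| - 2 * a))) ^ 3) ^ 3 = 0 := by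
  have h : min 1 (max 0 (|u| - 2 * a)) = 1 := min_eq_left (le_max_of_le_right (by linarith))
  rw [h]
  norm_num

/-- The cut-off defect kernel `u ↦ (2cosh(δu) - 2) χ_a(u)` (as a complex-valued function) is
continuous. [folklore] -/
theorem continuous_signConeCutoffKernel (a δ : ℝ) :
    Continuous fun u : ℝ ↦
      ((((2 * Real.cosh (δ * u) - 2) * (1 - (min 1 (max 0 (|u| - 2 * a))) ^ 3) ^ 3 : ℝ) : ℂ)) := by
  fun_prop

/-- The cut-off defect kernel `u ↦ (2cosh(δu) - 2) χ_a(u)` has compact support (it vanishes off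
`[-(2a+1), 2a+1]`). [folklore] -/
theorem hasCompactSupport_signConeCutoffKernel (a δ : ℝ) :
    HasCompactSupport fun u : ℝ ↦
      ((((2 * Real.cosh (δ * u) - 2) * (1 - (min 1 (max 0 (|u| - 2 * a))) ^ 3) ^ 3 : ℝ) : ℂ)) := by
  refine HasCompactSupport.intro (isCompact_Icc (a := -(2 * a + 1)) (b := 2 * a + 1))
    fun u hu ↦ ?_
  have hu' : 2 * a + 1 ≤ |u| := by
    rw [mem_Icc, not_and_or, not_le, not_le] at hu
    rcases hu with h | h
    · exact le_abs.2 (Or.inr (by linarith))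
    · exact le_abs.2 (Or.inl h.le)
  simp only [signConeCutoff_eq_zero hu', mul_zero, Complex.ofReal_zero]

/-! ### Abstract Fubini step -/

/-- Abstract form of the spectral identity. If `M` is continuous and integrable with
`∫ M(ξ) e^{-iξu} dξ = 2π k(u)` for every `u` (Fourier inversion), and `L` is continuous of
compact support, then `∫ k(u) L(u) e^{iγu} du = (1/2π) ∫ M(ξ) (∫ L(u) e^{i(γ-ξ)u} du) dξ`:
substitute the inversion formula for `k` and swap the integrals (Fubini; the integrand has
modulus `‖M(ξ)‖ ‖L(u)‖`). [folklore] -/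
theorem integral_mul_mul_cexp_eq_of_inversion {k M L : ℝ → ℂ}
    (hinv : ∀ u : ℝ, ∫ ξ : ℝ, M ξ * cexp (-(ξ * I) * u) = 2 * π * k u)
    (hMi : Integrable M) (hMc : Continuous M) (hLc : Continuous L)
    (hLs : HasCompactSupport L) (γ : ℝ) :
    (∫ u : ℝ, k u * L u * cexp (↑(γ * u) * I)) =
      (1 / (2 * π) : ℂ) * ∫ ξ : ℝ, M ξ * ∫ u : ℝ, L u * cexp (↑((γ - ξ) * u) * I) := by
  -- the Fubini integrand
  have hint : Integrable (Function.uncurry fun (ξ : ℝ) (u : ℝ) ↦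
      M ξ * (L u * cexp (↑((γ - ξ) * u) * I))) ((volume : Measure ℝ).prod volume) := by
    have hLi : Integrable L := hLc.integrable_of_hasCompactSupport hLs
    refine Integrable.mono' (hMi.mul_prod hLi).norm ?_ (Eventually.of_forall fun p ↦ ?_)
    · exact (by fun_prop : Continuous (Function.uncurry fun (ξ : ℝ) (u : ℝ) ↦
        M ξ * (L u * cexp (↑((γ - ξ) * u) * I)))).aestronglyMeasurable
    · obtain ⟨ξ, u⟩ := p
      simp only [Function.uncurry_apply_pair, norm_mul, Complex.norm_exp_ofReal_mul_I, mul_one,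
        le_refl]
  have h1 : (∫ ξ : ℝ, M ξ * ∫ u : ℝ, L u * cexp (↑((γ - ξ) * u) * I)) =
      ∫ ξ : ℝ, ∫ u : ℝ, M ξ * (L u * cexp (↑((γ - ξ) * u) * I)) := by
    congr 1 with ξ
    exact (integral_const_mul _ _).symm
  rw [h1, integral_integral_swap hint]
  -- the inner integral, by inversion
  have inner : ∀ u : ℝ, (∫ ξ : ℝ, M ξ * (L u * cexp (↑((γ - ξ) * u) * I))) =
      L u * cexp (↑(γ * u) * I) * (2 * π * k u) := by
    intro u
    rw [← hinv u, ← integral_const_mul]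
    congr 1 with ξ
    have e : cexp (↑((γ - ξ) * u) * I) = cexp (↑(γ * u) * I) * cexp (-(ξ * I) * u) := by
      rw [← Complex.exp_add]
      congr 1
      push_cast
      ring
    rw [e]
    ring
  simp_rw [inner]
  rw [← integral_const_mul]
  congr 1 with u
  have hπ : (π : ℂ) ≠ 0 := Complex.ofReal_ne_zero.mpr Real.pi_ne_zero
  field_simp

/-! ### The stub -/

/-- STUB B (spectral form of the defect). For a Weil test `g` supported in `[-a, a]`, `k = g ⋆ g̃`
(so `tsupport k ⊆ [-2a, 2a]`, where the cutoff `χ_a = 1`), Fourier inversion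
`2π k(u) = ∫ k̂(1/2 + iξ) e^{-iξu} dξ` (`weilMellin_inversion`), `k̂(1/2+iξ) = |ĝ(1/2+iξ)|²` and Fubini give
`D_k = (1/2π) ∫ |ĝ|² · L̂_{a,δ}(γ - ·)`. [folklore] -/
theorem stub_defectSpectral :
    ∀ a : ℝ, 0 < a → ∀ g : ℝ → ℂ, IsWeilTest g → tsupport g ⊆ Icc (-a) a → ∀ δ γ : ℝ,
      (∫ u : ℝ, weilConv g (weilReflect g) u * ((2 * Real.cosh (δ * u) - 2 : ℝ) : ℂ) * cexp (↑(γ * u) * I)) =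
        (1 / (2 * π) : ℂ) * ∫ ξ : ℝ, ((‖weilMellin g (1 / 2 + ξ * I)‖ ^ 2 : ℝ) : ℂ) *
          ∫ u : ℝ, (((2 * Real.cosh (δ * u) - 2) * (1 - (min 1 (max 0 (|u| - 2 * a))) ^ 3) ^ 3 : ℝ) : ℂ) *
            cexp (↑((γ - ξ) * u) * I) := by
  intro a _ g hg hsupp δ γ
  set k : ℝ → ℂ := weilConv g (weilReflect g) with hk_def
  have hk : IsWeilTest k := hg.weilConv hg.weilReflect
  have hks : tsupport k ⊆ Icc (-(2 * a)) (2 * a) :=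
    tsupport_weilConv_weilReflect_subset hg.2 hsupp
  -- Step 1: insert the cutoff, which is `1` on `tsupport k`.
  have step1 : (∫ u : ℝ, k u * ((2 * Real.cosh (δ * u) - 2 : ℝ) : ℂ) * cexp (↑(γ * u) * I)) =
      ∫ u : ℝ, k u *
        (((2 * Real.cosh (δ * u) - 2) * (1 - (min 1 (max 0 (|u| - 2 * a))) ^ 3) ^ 3 : ℝ) : ℂ) *
          cexp (↑(γ * u) * I) := by
    congr 1 with u
    by_cases hu : u ∈ tsupport k
    · have hu' := hks hu
      rw [signConeCutoff_eq_one (abs_le.2 ⟨hu'.1, hu'.2⟩), mul_one]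
    · rw [image_eq_zero_of_notMem_tsupport hu]
      simp
  -- Step 2: Mellin inversion on the critical line and Fubini.
  have h12 : ((1 / 2 : ℝ) : ℂ) = 1 / 2 := by norm_num
  have hMi : Integrable fun ξ : ℝ ↦ weilMellin k (1 / 2 + ξ * I) := by
    simpa only [h12] using integrable_weilMellin_vertical hk (1 / 2)
  have hMc : Continuous fun ξ : ℝ ↦ weilMellin k (1 / 2 + ξ * I) := by
    simpa only [h12] using continuous_weilMellin_vertical hk.1.continuous hk.2 (1 / 2)
  have hinv : ∀ u : ℝ,
      ∫ ξ : ℝ, weilMellin k (1 / 2 + ξ * I) * cexp (-(ξ * I) * u) = 2 * π * k u := by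
    intro u
    have h := weilMellin_inversion hk (1 / 2) u
    rw [h12] at h
    rw [h, sub_self, zero_mul, Complex.exp_zero, mul_one]
  rw [step1, integral_mul_mul_cexp_eq_of_inversion hinv hMi hMc
    (continuous_signConeCutoffKernel a δ) (hasCompactSupport_signConeCutoffKernel a δ) γ]
  congr 1
  refine integral_congr_ae (Eventually.of_forall fun ξ ↦ ?_)
  simp only
  rw [weilMellin_weilConv_weilReflect_half hg ξ]

end Summit.RiemannHypothesis.RiemannHypothesis.Theorems.OscCoherentCore

end
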